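import Literature.Combinatorics.StablePolynomials.BoundedDegreeRealStabilityPreservers
import HarnessLib

/-!
# Borcea–Brändén I, Theorems 1.1 and 1.2 for every `κ ∈ ℕⁿ` (blocks of degree zero allowed)

J. Borcea, P. Brändén, *The Lee–Yang and Pólya–Schur programs. I. Linear operators preserving stability*,
Invent. Math. 177 (2009) 541–569 (arXiv:0809.0401), §1.1, Theorems 1.1 and 1.2, are stated for an arbitrary
`κ ∈ ℕⁿ` and a linear operator `T : 𝕂_κ[z_1,…,z_n] → 𝕂[z_1,…,z_n]` on the space `𝕂_κ[z]` of polynomials of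
degree `≤ κ_i` in `z_i`. The tree proves them for `κ_i ≥ 1` (`BorceaBranden_stabilityPreserver_iff`,
`BorceaBranden_realStabilityPreserver_iff`: the reduction of §2.2 needs a section of the block map). This file
removes the restriction: for `κ_i = 0` the polynomials of `𝕂_κ[z]` do not involve `z_i`, and `T` is replaced by
`T' = T ∘ E` on `𝕂_{κ'}[z]`, `κ' = max(κ,1)`, where `E` sets `z_i := 0` for every `i` with `κ_i = 0`
(`killSet`). Setting variables to the real boundary point `0` maps stable polynomials to stable polynomials or
to `0` (tree `eq_zero_or_stable_of_eval_update_zero`, [cite: BorceaBranden2009II, §2 Lemma 2.4]-type closure),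
`E` is the identity on `𝕂_κ[z]`, `T'[(z+w)^{κ'}] = (Π_{κ_i=0} w_i) · T[(z+w)^κ]`, and the rank-one (resp.
rank-two) alternatives correspond; so Theorem 1.1 (1.2) for `κ'` gives Theorem 1.1 (1.2) for `κ`.

## Contents

* §1 `killSet S` (`z_i := 0`, `i ∈ S`): `eval_killSet`, `killSet_eq_self`, `degreeOf_killSet_le`,
  `killSet_eq_zero_or_stable`, `map_killSet`, `killSet_eq_zero_or_isRealStable`, `killSet_prod_X_add_C_pow`.
* §2 **`BorceaBranden_stabilityPreserver_iff'`** — Theorem 1.1 for every `κ : τ → ℕ`.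
* §3 `isRealStable_realBoundedDegreeSymbol_iff`, `isRealStable_realBoundedDegreeSymbolNeg_iff`,
  **`BorceaBranden_realStabilityPreserver_iff'`** — Theorem 1.2 for every `κ : τ → ℕ`.

## References

* [BorceaBranden2009] J. Borcea, P. Brändén, Invent. Math. 177 (2009) 541–569, §1.1 Thms. 1.1, 1.2.
* [BorceaBranden2009II] J. Borcea, P. Brändén, Comm. Pure Appl. Math. 62 (2009) 1595–1631, §2 (closure
  properties of stable polynomials under specialisation of variables).
-/

noncomputable section

open MvPolynomial Finset

namespace Literature.Combinatorics.StablePolynomials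

variable {τ : Type*}

/-! ## §1 Setting a set of variables to zero -/

section Kill

variable [DecidableEq τ]

/-- **`E_S`: the substitution `z_i := 0` for `i ∈ S`** (an algebra endomorphism of `R[z_τ]`).
[cite: BorceaBranden2009, §1.1 (the space `𝕂_κ[z]`: for `κ_i = 0` its elements do not involve `z_i`)] -/
def killSet {R : Type*} [CommSemiring R] (S : Finset τ) : MvPolynomial τ R →ₐ[R] MvPolynomial τ R :=
  bind₁ fun i => if i ∈ S then 0 else X i

/-- `(E_S p)(z) = p(z')` with `z'_i = 0` (`i ∈ S`), `z'_i = z_i` otherwise. [cite: BorceaBranden2009, §1.1] -/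
theorem eval_killSet {R : Type*} [CommSemiring R] (S : Finset τ) (z : τ → R) (p : MvPolynomial τ R) :
    eval z (killSet S p) = eval (fun i => if i ∈ S then 0 else z i) p := by
  have h : (fun i => eval z (if i ∈ S then (0 : MvPolynomial τ R) else X i)) =
      fun i => if i ∈ S then 0 else z i :=
    funext fun i => by split_ifs <;> simp
  rw [← h]
  exact eval₂Hom_bind₁ _ _ _ _

/-- `E_∅ = id`. [cite: BorceaBranden2009, §1.1] -/
theorem killSet_empty {R : Type*} [CommSemiring R] (p : MvPolynomial τ R) : killSet ∅ p = p := by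
  have h : (fun i => if i ∈ (∅ : Finset τ) then (0 : MvPolynomial τ R) else X i) = X :=
    funext fun i => by rw [if_neg (Finset.notMem_empty i)]
  rw [killSet, h, bind₁_X_left, AlgHom.id_apply]

/-- **`E_S` is the identity on polynomials not involving the `z_i`, `i ∈ S`.** [cite: BorceaBranden2009, §1.1] -/
theorem killSet_eq_self {R : Type*} [CommSemiring R] (S : Finset τ) {p : MvPolynomial τ R}
    (hp : ∀ i ∈ S, degreeOf i p = 0) : killSet S p = p := by
  conv_lhs => rw [p.as_sum, map_sum]
  conv_rhs => rw [p.as_sum]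
  refine sum_congr rfl fun s hs => ?_
  rw [killSet, bind₁_monomial, monomial_eq]
  congr 1
  refine prod_congr rfl fun i hi => ?_
  rw [if_neg]
  intro hiS
  have h1 : s i ≤ 0 := (monomial_le_degreeOf i hs).trans (hp i hiS).le
  exact (Finsupp.mem_support_iff.1 hi) (Nat.le_zero.1 h1)

/-- **Degrees after `E_S`**: `deg_{z_i} E_S p = 0` for `i ∈ S` and `≤ deg_{z_i} p` otherwise.
[cite: BorceaBranden2009, §1.1] -/
theorem degreeOf_killSet_le {R : Type*} [CommSemiring R] [Nontrivial R] (S : Finset τ)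
    (p : MvPolynomial τ R) (i : τ) :
    degreeOf i (killSet S p) ≤ if i ∈ S then 0 else degreeOf i p := by
  conv_lhs => rw [p.as_sum, map_sum]
  refine (degreeOf_sum_le _ _ _).trans (Finset.sup_le fun s hs => ?_)
  rw [killSet, bind₁_monomial]
  refine (degreeOf_C_mul_le _ _ _).trans ((degreeOf_prod_le _ _ _).trans ?_)
  have hterm : ∀ j ∈ s.support,
      degreeOf i ((if j ∈ S then (0 : MvPolynomial τ R) else X j) ^ s j) ≤
        if j = i then (if i ∈ S then 0 else s i) else 0 := by
    intro j _
    refine (degreeOf_pow_le _ _ _).trans ?_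
    by_cases hjS : j ∈ S
    · rw [if_pos hjS, degreeOf_zero, mul_zero]
      exact Nat.zero_le _
    · rw [if_neg hjS, degreeOf_X]
      by_cases hji : j = i
      · subst hji
        rw [if_pos rfl, if_pos rfl, if_neg hjS, mul_one]
      · rw [if_neg (Ne.symm hji), if_neg hji, mul_zero]
  refine (sum_le_sum hterm).trans ?_
  rw [sum_ite_eq']
  by_cases hiS : i ∈ S
  · rw [if_pos hiS, ite_self]
    exact Nat.zero_le _
  · rw [if_neg hiS]
    split_ifs
    · exact monomial_le_degreeOf i hs
    · exact Nat.zero_le _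

/-- **Setting variables to `0` maps stable polynomials to stable polynomials or to `0`.**
[cite: BorceaBranden2009II, §2 (closure of stability under `z_i ↦ 0`, boundary of `ℋ`)] -/
theorem killSet_eq_zero_or_stable [Fintype τ] (S : Finset τ) {p : MvPolynomial τ ℂ}
    (hp : p = 0 ∨ IsUpperHalfPlaneStable p) :
    killSet S p = 0 ∨ IsUpperHalfPlaneStable (killSet S p) := by
  induction S using Finset.induction_on with
  | empty => rwa [killSet_empty]
  | insert k S hk ih =>
    refine eq_zero_or_stable_of_eval_update_zero k ih fun z => ?_
    rw [eval_killSet, eval_killSet]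
    have h : (fun i => if i ∈ S then (0 : ℂ) else Function.update z k 0 i) =
        fun i => if i ∈ insert k S then 0 else z i := by
      funext i
      by_cases hi : i = k
      · subst hi
        rw [if_neg hk, Function.update_self, if_pos (mem_insert_self _ _)]
      · rw [Function.update_of_ne hi]
        by_cases hiS : i ∈ S
        · rw [if_pos hiS, if_pos (mem_insert_of_mem hiS)]
        · rw [if_neg hiS, if_neg (fun h => hiS ((mem_insert.1 h).resolve_left hi))]
    rw [h]

/-- `E_S` commutes with complexification. [cite: BorceaBranden2009, §1.1] -/
theorem map_killSet (S : Finset τ) (p : MvPolynomial τ ℝ) :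
    map (algebraMap ℝ ℂ) (killSet S p) = killSet S (map (algebraMap ℝ ℂ) p) := by
  rw [killSet, killSet, map_bind₁]
  have h : (fun i => map (algebraMap ℝ ℂ) (if i ∈ S then (0 : MvPolynomial τ ℝ) else X i)) =
      fun i => if i ∈ S then (0 : MvPolynomial τ ℂ) else X i :=
    funext fun i => by split_ifs <;> simp
  rw [h]

/-- **Real form**: `E_S` maps real stable polynomials to real stable polynomials or to `0`.
[cite: BorceaBranden2009II, §2] -/
theorem killSet_eq_zero_or_isRealStable [Fintype τ] (S : Finset τ) {p : MvPolynomial τ ℝ}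
    (hp : IsRealStable p) : killSet S p = 0 ∨ IsRealStable (killSet S p) := by
  rcases killSet_eq_zero_or_stable S (Or.inr hp) with h | h
  · rw [← map_killSet] at h
    exact Or.inl (map_injective (algebraMap ℝ ℂ) (algebraMap ℝ ℂ).injective (by rw [h, map_zero]))
  · rw [← map_killSet] at h
    exact Or.inr h

/-- **`E[(z+w)^{κ'}] = (Π_{κ_i = 0} w_i) · (z+w)^κ`** for `κ' = max(κ,1)` and `E` killing the `z_i` with
`κ_i = 0`. [cite: BorceaBranden2009, §1.1 (G_T = T[(z+w)^κ])] -/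
theorem killSet_prod_X_add_C_pow [Fintype τ] (κ : τ → ℕ) (w : τ → ℂ) :
    killSet (univ.filter fun i => κ i = 0) (∏ i, (X i + C (w i)) ^ max (κ i) 1 : MvPolynomial τ ℂ) =
      C (∏ i, if κ i = 0 then w i else 1) * ∏ i, (X i + C (w i)) ^ κ i := by
  rw [map_prod, map_prod, ← prod_mul_distrib]
  refine prod_congr rfl fun i _ => ?_
  rw [map_pow, map_add, killSet, bind₁_X_right, bind₁_C_right]
  by_cases hi : κ i = 0
  · rw [if_pos (show i ∈ univ.filter (fun i => κ i = 0) from mem_filter.2 ⟨mem_univ _, hi⟩), if_pos hi, hi,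
      zero_add, pow_zero, mul_one, max_eq_right (Nat.zero_le 1), pow_one]
  · rw [if_neg (show i ∉ univ.filter (fun i => κ i = 0) from fun h => hi (mem_filter.1 h).2), if_neg hi, C_1,
      one_mul, max_eq_left (Nat.one_le_iff_ne_zero.2 hi)]

omit [DecidableEq τ] in
/-- The scalar `Π_{κ_i = 0} w_i` is nonzero on `ℋ^τ`. [cite: BorceaBranden2009, §1.1] -/
theorem prod_ite_ne_zero [Fintype τ] (κ : τ → ℕ) {w : τ → ℂ} (hw : ∀ i, 0 < (w i).im) :
    (∏ i, if κ i = 0 then w i else (1 : ℂ)) ≠ 0 :=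
  prod_ne_zero_iff.2 fun i _ => by
    split_ifs
    · intro h
      have := hw i
      rw [h, Complex.zero_im] at this
      exact lt_irrefl _ this
    · exact one_ne_zero

end Kill

/-! ## §2 Theorem 1.1 for every `κ` -/

section Complex

variable [Fintype τ] [DecidableEq τ]

/-- **Borcea–Brändén I, Theorem 1.1, for every `κ ∈ ℕⁿ`.** A linear operator `T` on `ℂ[z_τ]` maps every
stable polynomial of `ℂ_κ[z_τ]` (degree `≤ κ_i` in `z_i`, `κ_i ≥ 0` arbitrary) to a stable polynomial or to `0`
iff (a) `T = α(·)P` on `ℂ_κ[z_τ]` with `P` stable, or (b) `G_T(z,w) = T[(z+w)^κ] ∈ 𝓗_{2n}(ℂ)`.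
[cite: BorceaBranden2009, §1.1 Thm. 1.1] -/
theorem BorceaBranden_stabilityPreserver_iff' (κ : τ → ℕ) (T : MvPolynomial τ ℂ →ₗ[ℂ] MvPolynomial τ ℂ) :
    (∀ p : MvPolynomial τ ℂ, (∀ i, degreeOf i p ≤ κ i) → IsUpperHalfPlaneStable p →
        IsUpperHalfPlaneStable (T p) ∨ T p = 0) ↔
      ((∃ (α : MvPolynomial τ ℂ →ₗ[ℂ] ℂ) (P : MvPolynomial τ ℂ), IsUpperHalfPlaneStable P ∧
          ∀ p : MvPolynomial τ ℂ, (∀ i, degreeOf i p ≤ κ i) → T p = α p • P) ∨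
        IsUpperHalfPlaneStable (boundedDegreeSymbol κ T)) := by
  set Z : Finset τ := univ.filter fun i => κ i = 0 with hZ
  set E : MvPolynomial τ ℂ →ₐ[ℂ] MvPolynomial τ ℂ := killSet Z with hE
  set κ' : τ → ℕ := fun i => max (κ i) 1 with hκ'
  have hκ'1 : ∀ i, 0 < κ' i := fun i => lt_of_lt_of_le Nat.one_pos (le_max_right _ _)
  set T' : MvPolynomial τ ℂ →ₗ[ℂ] MvPolynomial τ ℂ := T ∘ₗ E.toLinearMap with hT'
  have hT'app : ∀ p, T' p = T (E p) := fun p => rfl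
  -- degrees
  have hd1 : ∀ p : MvPolynomial τ ℂ, (∀ i, degreeOf i p ≤ κ' i) → ∀ i, degreeOf i (E p) ≤ κ i := by
    intro p hp i
    refine (degreeOf_killSet_le Z p i).trans ?_
    by_cases hi : κ i = 0
    · rw [if_pos (show i ∈ Z from mem_filter.2 ⟨mem_univ _, hi⟩), hi]
    · rw [if_neg (show i ∉ Z from fun h => hi (mem_filter.1 h).2)]
      exact (hp i).trans (max_eq_left (Nat.one_le_iff_ne_zero.2 hi)).le
  have hd2 : ∀ p : MvPolynomial τ ℂ, (∀ i, degreeOf i p ≤ κ i) → E p = p := fun p hp =>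
    killSet_eq_self Z fun i hi => Nat.le_zero.1 ((hp i).trans ((mem_filter.1 hi).2).le)
  have hd3 : ∀ p : MvPolynomial τ ℂ, (∀ i, degreeOf i p ≤ κ i) → ∀ i, degreeOf i p ≤ κ' i :=
    fun p hp i => (hp i).trans (le_max_left _ _)
  -- preservation
  have hpres : (∀ p : MvPolynomial τ ℂ, (∀ i, degreeOf i p ≤ κ i) → IsUpperHalfPlaneStable p →
      IsUpperHalfPlaneStable (T p) ∨ T p = 0) ↔
      ∀ p : MvPolynomial τ ℂ, (∀ i, degreeOf i p ≤ κ' i) → IsUpperHalfPlaneStable p →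
        IsUpperHalfPlaneStable (T' p) ∨ T' p = 0 := by
    constructor
    · intro h p hp hs
      rw [hT'app]
      rcases killSet_eq_zero_or_stable Z (Or.inr hs) with h0 | h1
      · right
        have h0' : E p = 0 := h0
        rw [h0', map_zero]
      · exact h _ (hd1 p hp) h1
    · intro h p hp hs
      have h' := h p (hd3 p hp) hs
      rwa [hT'app, hd2 p hp] at h'
  -- rank one
  have hrank : (∃ (α : MvPolynomial τ ℂ →ₗ[ℂ] ℂ) (P : MvPolynomial τ ℂ), IsUpperHalfPlaneStable P ∧
        ∀ p : MvPolynomial τ ℂ, (∀ i, degreeOf i p ≤ κ' i) → T' p = α p • P) ↔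
      ∃ (α : MvPolynomial τ ℂ →ₗ[ℂ] ℂ) (P : MvPolynomial τ ℂ), IsUpperHalfPlaneStable P ∧
        ∀ p : MvPolynomial τ ℂ, (∀ i, degreeOf i p ≤ κ i) → T p = α p • P := by
    constructor
    · rintro ⟨α, P, hP, h⟩
      refine ⟨α, P, hP, fun p hp => ?_⟩
      rw [← hd2 p hp, ← hT'app, h p (hd3 p hp)]
      rw [hd2 p hp]
    · rintro ⟨α, P, hP, h⟩
      refine ⟨α ∘ₗ E.toLinearMap, P, hP, fun p hp => ?_⟩
      rw [hT'app, h _ (hd1 p hp), LinearMap.comp_apply, AlgHom.toLinearMap_apply]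
  -- symbols
  have hsymb : IsUpperHalfPlaneStable (boundedDegreeSymbol κ' T') ↔
      IsUpperHalfPlaneStable (boundedDegreeSymbol κ T) := by
    rw [isUpperHalfPlaneStable_boundedDegreeSymbol_iff, isUpperHalfPlaneStable_boundedDegreeSymbol_iff]
    refine forall_congr' fun z => forall_congr' fun w => forall_congr' fun hz => forall_congr' fun hw => ?_
    rw [hT'app, hE, killSet_prod_X_add_C_pow, ← smul_eq_C_mul, map_smul, smul_eval]
    exact ⟨fun h h0 => h (by rw [h0, mul_zero]), fun h => mul_ne_zero (prod_ite_ne_zero κ hw) h⟩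
  rw [hpres, BorceaBranden_stabilityPreserver_iff hκ'1 T', hrank, hsymb]

end Complex

/-! ## §3 Theorem 1.2 for every `κ` -/

section Real

variable [Fintype τ] [DecidableEq τ]

/-- **(b) in evaluation form**: `G_T(z,w) ∈ 𝓗_{2n}(ℝ)` iff `T_ℂ[Π (z_i+w_i)^{κ_i}](z) ≠ 0` on `ℋ^τ × ℋ^τ`.
[cite: BorceaBranden2009, §1.1 Thm. 1.2 (b)] -/
theorem isRealStable_realBoundedDegreeSymbol_iff (κ : τ → ℕ) (T : MvPolynomial τ ℝ →ₗ[ℝ] MvPolynomial τ ℝ) :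
    IsRealStable (realBoundedDegreeSymbol κ T) ↔
      ∀ z w : τ → ℂ, (∀ i, 0 < (z i).im) → (∀ i, 0 < (w i).im) →
        eval z (complexify T (∏ i, (X i + C (w i)) ^ κ i)) ≠ 0 := by
  rw [IsRealStable, map_realBoundedDegreeSymbol, isUpperHalfPlaneStable_boundedDegreeSymbol_iff]

/-- **(c) in evaluation form**: `G_T(z,-w) ∈ 𝓗_{2n}(ℝ)` iff `T_ℂ[Π (z_i-w_i)^{κ_i}](z) ≠ 0` on `ℋ^τ × ℋ^τ`.
[cite: BorceaBranden2009, §1.1 Thm. 1.2 (c)] -/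
theorem isRealStable_realBoundedDegreeSymbolNeg_iff (κ : τ → ℕ) (T : MvPolynomial τ ℝ →ₗ[ℝ] MvPolynomial τ ℝ) :
    IsRealStable (realBoundedDegreeSymbolNeg κ T) ↔
      ∀ z w : τ → ℂ, (∀ i, 0 < (z i).im) → (∀ i, 0 < (w i).im) →
        eval z (complexify T (∏ i, (X i + C (-w i)) ^ κ i)) ≠ 0 := by
  rw [IsRealStable]
  constructor
  · intro h' z w hz hw
    have h'' := h' (Sum.elim z w) (by rintro (i | i) <;> simp [hz, hw])
    rwa [eval_map_realBoundedDegreeSymbolNeg] at h''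
  · intro h' zw hzw
    rw [← Sum.elim_comp_inl_inr zw, eval_map_realBoundedDegreeSymbolNeg]
    exact h' _ _ (fun i => hzw (Sum.inl i)) fun i => hzw (Sum.inr i)

omit [Fintype τ] in
/-- `(T ∘ E)_ℂ = T_ℂ ∘ E`. [cite: BorceaBranden2009, §4 proof of Thm. 1.2 (complexification)] -/
theorem complexify_comp_killSet (S : Finset τ) (T : MvPolynomial τ ℝ →ₗ[ℝ] MvPolynomial τ ℝ) :
    complexify (T ∘ₗ (killSet S : MvPolynomial τ ℝ →ₐ[ℝ] MvPolynomial τ ℝ).toLinearMap) =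
      complexify T ∘ₗ (killSet S : MvPolynomial τ ℂ →ₐ[ℂ] MvPolynomial τ ℂ).toLinearMap := by
  refine (basisMonomials τ ℂ).ext fun m => ?_
  have hm : (basisMonomials τ ℂ m : MvPolynomial τ ℂ) = map (algebraMap ℝ ℂ) (monomial m 1) := by
    rw [coe_basisMonomials, map_monomial, map_one]
  rw [hm, complexify_map, LinearMap.comp_apply, LinearMap.comp_apply, AlgHom.toLinearMap_apply,
    AlgHom.toLinearMap_apply, ← map_killSet, complexify_map]

/-- **Borcea–Brändén I, Theorem 1.2, for every `κ ∈ ℕⁿ`.** A linear operator `T` on `ℝ[z_τ]` maps every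
real stable polynomial of `ℝ_κ[z_τ]` (`κ_i ≥ 0` arbitrary) to a real stable polynomial or to `0` iff
(a) `T = α(·)P + β(·)Q` on `ℝ_κ[z_τ]` with `P ≪ Q` real stable, or (b) `G_T(z,w) ∈ 𝓗_{2n}(ℝ)`, or
(c) `G_T(z,-w) ∈ 𝓗_{2n}(ℝ)`. [cite: BorceaBranden2009, §1.1 Thm. 1.2] -/
theorem BorceaBranden_realStabilityPreserver_iff' (κ : τ → ℕ) (T : MvPolynomial τ ℝ →ₗ[ℝ] MvPolynomial τ ℝ) :
    (∀ p : MvPolynomial τ ℝ, (∀ i, degreeOf i p ≤ κ i) → IsRealStable p → IsRealStable (T p) ∨ T p = 0) ↔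
      ((∃ (α β : MvPolynomial τ ℝ →ₗ[ℝ] ℝ) (P Q : MvPolynomial τ ℝ), IsRealStable P ∧ IsRealStable Q ∧
          IsProperPosition P Q ∧ ∀ p : MvPolynomial τ ℝ, (∀ i, degreeOf i p ≤ κ i) → T p = α p • P + β p • Q) ∨
        IsRealStable (realBoundedDegreeSymbol κ T) ∨ IsRealStable (realBoundedDegreeSymbolNeg κ T)) := by
  set Z : Finset τ := univ.filter fun i => κ i = 0 with hZ
  set E : MvPolynomial τ ℝ →ₐ[ℝ] MvPolynomial τ ℝ := killSet Z with hE
  set κ' : τ → ℕ := fun i => max (κ i) 1 with hκ'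
  have hκ'1 : ∀ i, 0 < κ' i := fun i => lt_of_lt_of_le Nat.one_pos (le_max_right _ _)
  set T' : MvPolynomial τ ℝ →ₗ[ℝ] MvPolynomial τ ℝ := T ∘ₗ E.toLinearMap with hT'
  have hT'app : ∀ p, T' p = T (E p) := fun p => rfl
  -- degrees
  have hd1 : ∀ p : MvPolynomial τ ℝ, (∀ i, degreeOf i p ≤ κ' i) → ∀ i, degreeOf i (E p) ≤ κ i := by
    intro p hp i
    refine (degreeOf_killSet_le Z p i).trans ?_
    by_cases hi : κ i = 0
    · rw [if_pos (show i ∈ Z from mem_filter.2 ⟨mem_univ _, hi⟩), hi]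
    · rw [if_neg (show i ∉ Z from fun h => hi (mem_filter.1 h).2)]
      exact (hp i).trans (max_eq_left (Nat.one_le_iff_ne_zero.2 hi)).le
  have hd2 : ∀ p : MvPolynomial τ ℝ, (∀ i, degreeOf i p ≤ κ i) → E p = p := fun p hp =>
    killSet_eq_self Z fun i hi => Nat.le_zero.1 ((hp i).trans ((mem_filter.1 hi).2).le)
  have hd3 : ∀ p : MvPolynomial τ ℝ, (∀ i, degreeOf i p ≤ κ i) → ∀ i, degreeOf i p ≤ κ' i :=
    fun p hp i => (hp i).trans (le_max_left _ _)
  -- preservation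
  have hpres : (∀ p : MvPolynomial τ ℝ, (∀ i, degreeOf i p ≤ κ i) → IsRealStable p →
      IsRealStable (T p) ∨ T p = 0) ↔
      ∀ p : MvPolynomial τ ℝ, (∀ i, degreeOf i p ≤ κ' i) → IsRealStable p →
        IsRealStable (T' p) ∨ T' p = 0 := by
    constructor
    · intro h p hp hs
      rw [hT'app]
      rcases killSet_eq_zero_or_isRealStable Z hs with h0 | h1
      · right
        have h0' : E p = 0 := h0
        rw [h0', map_zero]
      · exact h _ (hd1 p hp) h1
    · intro h p hp hs
      have h' := h p (hd3 p hp) hs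
      rwa [hT'app, hd2 p hp] at h'
  -- rank two
  have hrank : (∃ (α β : MvPolynomial τ ℝ →ₗ[ℝ] ℝ) (P Q : MvPolynomial τ ℝ), IsRealStable P ∧ IsRealStable Q ∧
        IsProperPosition P Q ∧ ∀ p : MvPolynomial τ ℝ, (∀ i, degreeOf i p ≤ κ' i) → T' p = α p • P + β p • Q) ↔
      ∃ (α β : MvPolynomial τ ℝ →ₗ[ℝ] ℝ) (P Q : MvPolynomial τ ℝ), IsRealStable P ∧ IsRealStable Q ∧
        IsProperPosition P Q ∧ ∀ p : MvPolynomial τ ℝ, (∀ i, degreeOf i p ≤ κ i) → T p = α p • P + β p • Q := by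
    constructor
    · rintro ⟨α, β, P, Q, hP, hQ, hPQ, h⟩
      refine ⟨α, β, P, Q, hP, hQ, hPQ, fun p hp => ?_⟩
      rw [← hd2 p hp, ← hT'app, h p (hd3 p hp)]
      rw [hd2 p hp]
    · rintro ⟨α, β, P, Q, hP, hQ, hPQ, h⟩
      refine ⟨α ∘ₗ E.toLinearMap, β ∘ₗ E.toLinearMap, P, Q, hP, hQ, hPQ, fun p hp => ?_⟩
      rw [hT'app, h _ (hd1 p hp), LinearMap.comp_apply, LinearMap.comp_apply, AlgHom.toLinearMap_apply]
  -- symbols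
  have hC : complexify T' = complexify T ∘ₗ (killSet Z : MvPolynomial τ ℂ →ₐ[ℂ] MvPolynomial τ ℂ).toLinearMap := by
    rw [hT', hE, complexify_comp_killSet]
  have hb : IsRealStable (realBoundedDegreeSymbol κ' T') ↔ IsRealStable (realBoundedDegreeSymbol κ T) := by
    rw [isRealStable_realBoundedDegreeSymbol_iff, isRealStable_realBoundedDegreeSymbol_iff]
    refine forall_congr' fun z => forall_congr' fun w => forall_congr' fun hz => forall_congr' fun hw => ?_
    rw [hC, LinearMap.comp_apply, AlgHom.toLinearMap_apply, hZ, killSet_prod_X_add_C_pow, ← smul_eq_C_mul,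
      map_smul, smul_eval]
    exact ⟨fun h h0 => h (by rw [h0, mul_zero]), fun h => mul_ne_zero (prod_ite_ne_zero κ hw) h⟩
  have hc : IsRealStable (realBoundedDegreeSymbolNeg κ' T') ↔ IsRealStable (realBoundedDegreeSymbolNeg κ T) := by
    rw [isRealStable_realBoundedDegreeSymbolNeg_iff, isRealStable_realBoundedDegreeSymbolNeg_iff]
    refine forall_congr' fun z => forall_congr' fun w => forall_congr' fun hz => forall_congr' fun hw => ?_
    have hw' : ∀ i, (-w i) = (-w) i := fun i => rfl
    simp only [hw']
    rw [hC, LinearMap.comp_apply, AlgHom.toLinearMap_apply, hZ, killSet_prod_X_add_C_pow, ← smul_eq_C_mul,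
      map_smul, smul_eval]
    refine ⟨fun h h0 => h (by rw [h0, mul_zero]), fun h => mul_ne_zero (prod_ne_zero_iff.2 fun i _ => ?_) h⟩
    split_ifs
    · rw [Pi.neg_apply, neg_ne_zero]
      intro h0
      have := hw i
      rw [h0, Complex.zero_im] at this
      exact lt_irrefl _ this
    · exact one_ne_zero
  rw [hpres, BorceaBranden_realStabilityPreserver_iff hκ'1 T', hrank, hb, hc]

end Real

end Literature.Combinatorics.StablePolynomials

end
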